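import Mathlib
import Literature.Computability.AlgebraicComplexity.PrattTrapezoidVal
import Literature.Computability.AlgebraicComplexity.LocalStrongUSP
import Summits.MatrixMultiplication.MatrixMultiplication.Theorems.SoloBlindPrattValCyclic

/-!
# A local strong USP of width 9 and size 14: `Val(ℤ/nℤ) ≥ 13 n` for nine coprime moduli `≥ 128`

Solo-blind line Q12 (Pratt, arXiv:2309.03878), ninth file.  The balanced SAT search of this seat
found size `14` at width `9` (kissat, 1063 s), and `15` is impossible within the two-symbol-column
block class in which all record puzzles of this line live (there the local-strong-USP condition of
CKSU 2005 §6.1 becomes: no ordered triple `(u,v,w)`, not all equal, with `α(w) ⊆ α(v)`,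
`β(w) ⊆ β(u)`, `γ(v) ⊆ γ(u)` for the subset coordinates `α, β, γ` of the three blocks).  Per-coordinate
rate `14^{1/9} ≈ 1.3408`, the best this line has in the kernel.  Verified by `decide`, with the
corollaries `14 · ∏ⱼ (mⱼ − 1) ≤ Val(ℤ/nℤ)` (nine pairwise coprime moduli), `Val(ℤ/nℤ) ≥ 13 n` when all
nine moduli are `≥ 128` (`14 · (127/128)^9 > 13`), and `Val(K⁹) ≥ 14 (|K| − 1)⁹`.
-/

set_option linter.dupNamespace false
set_option maxRecDepth 4000

namespace Summit.MatrixMultiplication.MatrixMultiplication.Theorems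

open Finset Literature.Computability.AlgebraicComplexity

/-- The width-9 local strong USP of size 14 found by SAT search (symbols `1,2,3` coded `0,1,2`;
columns `0,3,4` use only `2,3`, columns `1,2,7` only `1,3`, columns `5,6,8` only `1,2`):
`333222111, 331322211, 331221231, 313232211, 311332212, 311321232, 311232132, 233321112, 233221131, 231332112, 231231132, 213331212, 213321231, 213232131`. -/
theorem soloVal_isLocalStrongUSP_width9_size14 :
    IsLocalStrongUSP
      ![![(2 : Fin 3), 2, 2, 1, 1, 1, 0, 0, 0],
      ![(2 : Fin 3), 2, 0, 2, 1, 1, 1, 0, 0],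
      ![(2 : Fin 3), 2, 0, 1, 1, 0, 1, 2, 0],
      ![(2 : Fin 3), 0, 2, 1, 2, 1, 1, 0, 0],
      ![(2 : Fin 3), 0, 0, 2, 2, 1, 1, 0, 1],
      ![(2 : Fin 3), 0, 0, 2, 1, 0, 1, 2, 1],
      ![(2 : Fin 3), 0, 0, 1, 2, 1, 0, 2, 1],
      ![(1 : Fin 3), 2, 2, 2, 1, 0, 0, 0, 1],
      ![(1 : Fin 3), 2, 2, 1, 1, 0, 0, 2, 0],
      ![(1 : Fin 3), 2, 0, 2, 2, 1, 0, 0, 1],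
      ![(1 : Fin 3), 2, 0, 1, 2, 0, 0, 2, 1],
      ![(1 : Fin 3), 0, 2, 2, 2, 0, 1, 0, 1],
      ![(1 : Fin 3), 0, 2, 2, 1, 0, 1, 2, 0],
      ![(1 : Fin 3), 0, 2, 1, 2, 1, 0, 2, 0]] := by
  unfold IsLocalStrongUSP localStrongUSPPatterns
  decide

/-- **Nine-modulus block, size 14.**  For pairwise coprime moduli `m₀, …, m₈ ≥ 1` with product `n`:
`14 · ∏ⱼ (mⱼ − 1) ≤ Val(ℤ/nℤ)`. -/
theorem soloVal_nineBlock14 (m : Fin 9 → ℕ) (hm0 : ∀ j, m j ≠ 0)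
    (hm : Pairwise (Function.onFun Nat.Coprime m)) (n : ℕ) [NeZero n] (hn : n = ∏ j, m j) :
    14 * ∏ j, (m j - 1) ≤ prattVal (ZMod n) :=
  soloVal_le_prattVal_zmod_of_isLocalStrongUSP soloVal_isLocalStrongUSP_width9_size14 m hm0 hm n hn

/-- **Nine coprime moduli `≥ 128` give `Val(ℤ/nℤ) ≥ 13 n`** (`14 · (127/128)^9 > 13`). -/
theorem soloVal_nineBlock14_ge128 (m : Fin 9 → ℕ) (h128 : ∀ j, 128 ≤ m j)
    (hm : Pairwise (Function.onFun Nat.Coprime m)) (n : ℕ) [NeZero n] (hn : n = ∏ j, m j) :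
    13 * n ≤ prattVal (ZMod n) := by
  have h := soloVal_nineBlock14 m (fun j => by have := h128 j; omega) hm n hn
  have hprod : ∏ j, (127 * m j) ≤ ∏ j, (128 * (m j - 1)) :=
    Finset.prod_le_prod' fun j _ => by have := h128 j; omega
  rw [Finset.prod_mul_distrib, Finset.prod_mul_distrib, Finset.prod_const, Finset.prod_const,
    Finset.card_univ, Fintype.card_fin, ← hn] at hprod
  obtain ⟨P, hP⟩ : ∃ P, ∏ j, (m j - 1) = P := ⟨_, rfl⟩
  rw [hP] at h hprod
  norm_num at hprod
  omega

/-- **`14 · (|K| − 1)⁹ ≤ Val(K⁹)`** for every finite abelian group `K`. -/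
theorem soloVal_ninth_le_prattVal14 (K : Type*) [AddCommGroup K] [Fintype K] [DecidableEq K] :
    14 * (Fintype.card K - 1) ^ 9 ≤ prattVal (Fin 9 → K) := by
  have h := soloVal_le_prattVal_pi_of_isLocalStrongUSP (K := fun _ : Fin 9 => K)
    soloVal_isLocalStrongUSP_width9_size14
  simpa [Finset.prod_const, Finset.card_univ, Fintype.card_fin] using h

end Summit.MatrixMultiplication.MatrixMultiplication.Theorems
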